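import Summits.ResolutionOfSingularities.ResolutionOfSingularities.Theorems.PurelyInseparableDim4ResConeDInfLoseStep
import HarnessLib
import HarnessLib.Audit.Tags

/-!
# Purely inseparable four-folds — the HEAVY LOSE STEP, p-GENERIC (the LOSE third of «(p, d) heavy line ⟸ weights pattern»)
# (cell `res-dim4-pi`, K2(p) lane, slice C; §18 «p-generic inventory toward K2(7)» of the lane holder res-dim4-p-12 g4)

[OURS · counted 0 · cell `res-dim4-pi` · K2(p) lane holder res-dim4-p-12 g4 (HOLDER WORDS 2026-08-29 08:08Z: next rung = the p-GENERIC
inventory; brick «(p, p−1) D∞-type heavy line ⟸ W_{p−1}-pattern» with the weights pattern as a NAMED HYPOTHESIS); seat res-dim4-p-2 g5 over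
its own (5,3)/(5,4) LOSE steps `…ResConeBInfLoseStep` (p704833) / `…ResConeDInfLoseStep` (p707423) and res-dim4-p-11 g4/g5's Φ-line.]
Nothing here proves TAIL-D, K2(5), K2(7), the β_h line or resolution of singularities in dimension ≥ 4 / characteristic `p` — NOT proved.
AI kernel work, weaker than expert review.

In `bInf_lose_step` ((p,d) = (5,3)) and `dInf_lose_step` ((5,4)) every Φ-line input is p-generic already
(`direction_mem_resVertex_of_shade_eq (q)`, twist / replace-row / arrival inverses, XIV / VII / II / XIII / XI with `d < p`, (K-Φ2) XV §4
`betaS_step_le_of_lose_of_child_pow {p d n}`, (R3b-n) `betaS_step_le_of_lose_translated_of_child_pow {p d n}`, (T2)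
`mul_alphaS_le_of_isIsolated {p d n}`, XVI `exists_label_readaptation_of_step_pow (p)`); the `(5,d)`-specific content is exactly three
inputs — the factorisation package, the weights-pattern fact «the step hits the heavy letter `h` and the newborn `j k` gets a weight
`w′ = |r| + d − p` with `p ∤ w′`», and the numerals.  **`heavy_lose_step`** turns those three into BINDERS: for a prime `p`, a level
`d < p`, a cleaning exponent `n` with `w′ + n = p`, `1 ≤ n ≤ d`, a `Step0 p` edge `c k → c (k+1)` recorded in chart `j k` at `b k` with
the factorisations `F_k = x^{r_k}·G` (`ord₀ G = d`, `p < |r_k| + d < 2p`, `x^{r_k} ∣ F_k`), `(step …).F = x^{r′}·G₁ = F_{k+1}/x^{r_{k+1}}·x^{…}`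
(`ord₀ G₁ = d`), constant shade, `e_G = 2` at both ends, an isolated child, and the pattern (`j k = h ∨ b k h ≠ 0`,
`r_{k+1} (j k) = |r_k| + d − p`, `p ∤ |r_k| + d − p`): an ENTRY frame at `k` (left inverse, `u₁ = e_h`, y-rows ⟂ `resVertex (c k)`,
`pts ≠ ∅`, `d! < δs`) yields a RUN frame at `k+1` (`u₁′ = e_{j k}`, y′-rows ⟂ `resVertex (c (k+1))`, `pts′ ≠ ∅`, `d! < δs′`,
**`d·αs′ ≤ (n − 1)·d!`** — the p-generic form of `2αs′ ≤ 4!`, i.e. `α′ ≤ (n−1)/d` — and `0 < αs′`) with `βs′ ≤ βs`.  Proof =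
`dInf_lose_step`'s, token for token.  Instances (not re-landed): `(p,d,n) = (5,4,3)` over `dInf_factorisation`/`dInf_pattern` is
`dInf_lose_step`; `(5,3,3)` over `bInf_factorisation`/`bInf_pattern` is `bInf_lose_step`.  The pattern binders are what a W_{p−1}
automaton word (res-dim4-idea-4 / res-dim4-idea-1, `(7,6)`) would discharge.

[cite: CossartJannsenSaito2020, Lemma 11.5, Lemma 12.1 (3), Lemma 12.2 (1), Lemma 13.6] [cite: CossartPiltant2008, (16), Lemma 4.5 (2)]
[cite: Hauser2010, §§F–G]  bears_on: LADDER-RESOLUTION:D157-DOOR2 (res-dim4-pi · K2(p) · slice C heavy line · p-generic LOSE step).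
Supports stmt-ResolutionOfSingularities-16155 (helper).
-/

set_option linter.dupNamespace false -- mandated namespace of this single-conjunct summit

noncomputable section

namespace Summit.ResolutionOfSingularities.ResolutionOfSingularities.Theorems.PIDim4


namespace ResCone

open MvPolynomial Finset IsLocalRing
open Literature.AlgebraicGeometry.Resolution
open Literature.AlgebraicGeometry.Resolution.CentreBlowup
open Literature.AlgebraicGeometry.Resolution.Hauser2010
open Literature.AlgebraicGeometry.Resolution.HauserPerlega2019
open Literature.AlgebraicGeometry.Resolution.WeightedOrder
open PointBlowup (direction additiveSubspace)

variable {K : Type} [Field K]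

/-- `d·a ≤ (n−1)·d!` and `1 ≤ n`, `1 ≤ d` give the (T1) threshold `d·(a+1) ≤ n·d!`. [folklore] -/
theorem mul_succ_le_mul_factorial {d n a : ℕ} (h : d * a ≤ (n - 1) * d.factorial) (hn : 1 ≤ n) :
    d * (a + 1) ≤ n * d.factorial := by
  obtain ⟨m, rfl⟩ := Nat.exists_eq_add_of_le' hn
  rw [Nat.add_sub_cancel] at h
  have hd : d ≤ d.factorial := Nat.self_le_factorial d
  nlinarith [h, hd]

/-- `d·a ≤ (n−1)·d!` and `n ≤ d` give `a < d!` (the abscissa bound `α < 1` used by the re-adaptation XVI). [folklore] -/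
theorem lt_factorial_of_mul_le {d n a : ℕ} (h : d * a ≤ (n - 1) * d.factorial) (hnd : n ≤ d) (hn : 1 ≤ n) :
    a < d.factorial := by
  have hd : 0 < d := by omega
  have h1 : (n - 1) * d.factorial < d * d.factorial := Nat.mul_lt_mul_of_pos_right (by omega) (Nat.factorial_pos d)
  exact Nat.lt_of_mul_lt_mul_left (h.trans_lt h1)

section Lose

variable [DecidableEq K]

/-- **THE HEAVY LOSE STEP, p-GENERIC** (factorisations, weights pattern and numerology as binders).  See the module docstring.
[OURS] [cite: CossartJannsenSaito2020, Lemma 12.1 (3), Lemma 12.2 (1), Lemma 13.6] [cite: CossartPiltant2008, Lemma 4.5 (2)] -/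
theorem heavy_lose_step {p d n : ℕ} [CharP K p] {c : ℕ → State K} {j : ℕ → Fin 4} {b : ℕ → Fin 4 → K} {k : ℕ} {h : Fin 4}
    {G G₁ : MvPolynomial (Fin 4) K}
    -- numerology
    (hdp : d < p) (hn1 : 1 ≤ n) (hnd : n ≤ d) (hnp : (c k).r.degree + d - p + n = p)
    (hpo : p < (c k).r.degree + d) (ho2 : (c k).r.degree + d < 2 * p) (hndvd : ¬ p ∣ ((c k).r.degree + d - p))
    -- the factorisation package at `k` and `k + 1` and of the step
    (hF : (c k).F = monomial (c k).r 1 * G) (hd : ordZero G = d) (hdiv : ∀ e ∈ (c k).F.support, (c k).r ≤ e)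
    (hbj : b k (j k) = 0)
    (hF' : (CentreBlowup.step p Finset.univ (j k) (b k) (c k)).F =
      monomial ((((c k).r.filter fun i => b k i = 0)).update (j k) ((c k).r.degree + d - p)) 1 * G₁)
    (hF₁ : (c (k + 1)).F = monomial (c (k + 1)).r 1 * G₁) (hd₁ : ordZero G₁ = d) (hiso₁ : IsIsolated p (c (k + 1)).F)
    (hshade : (CentreBlowup.step p Finset.univ (j k) (b k) (c k)).shade = (c k).shade)
    (he : Module.finrank K (resVertex (c k)) = 2) (he₁ : Module.finrank K (resVertex (c (k + 1))) = 2)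
    -- the weights pattern: the step hits the heavy letter `h`, the newborn `j k` has weight `|r_k| + d − p`
    (hhit : j k = h ∨ b k h ≠ 0) (hr' : (c (k + 1)).r (j k) = (c k).r.degree + d - p)
    -- the ENTRY frame
    {L : Fin (2 + 2) → Fin 4 → K} {M : Fin 4 → Fin (2 + 2) → K} (hM : ∀ t u, ∑ i, M t i * L i u = if t = u then 1 else 0)
    (hLu1 : L (u1 2) = Pi.single h 1)
    (hy : ∀ i, i ≠ u1 2 → i ≠ u2 2 → ∀ w ∈ resVertex (c k), ∑ t, L i t * w t = 0)
    (hne : (pts (fun i => algebraMap (MvPolynomial (Fin 4) K) (OriginLocalization K 4) (∑ t, C (L i t) * X t))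
      (Ideal.span {algebraMap (MvPolynomial (Fin 4) K) (OriginLocalization K 4) G}) d).Nonempty)
    (hδ : Nat.factorial d < deltaS (fun i => algebraMap (MvPolynomial (Fin 4) K) (OriginLocalization K 4) (∑ t, C (L i t) * X t))
      (Ideal.span {algebraMap (MvPolynomial (Fin 4) K) (OriginLocalization K 4) G}) d) :
    ∃ (L' : Fin (2 + 2) → Fin 4 → K) (M' : Fin 4 → Fin (2 + 2) → K),
      ((∀ t u, ∑ i, M' t i * L' i u = if t = u then 1 else 0) ∧ L' (u1 2) = Pi.single (j k) 1 ∧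
        (∀ i, i ≠ u1 2 → i ≠ u2 2 → ∀ w ∈ resVertex (c (k + 1)), ∑ t, L' i t * w t = 0) ∧
        (pts (fun i => algebraMap (MvPolynomial (Fin 4) K) (OriginLocalization K 4) (∑ t, C (L' i t) * X t))
          (Ideal.span {algebraMap (MvPolynomial (Fin 4) K) (OriginLocalization K 4) G₁}) d).Nonempty ∧
        Nat.factorial d < deltaS (fun i => algebraMap (MvPolynomial (Fin 4) K) (OriginLocalization K 4) (∑ t, C (L' i t) * X t))
          (Ideal.span {algebraMap (MvPolynomial (Fin 4) K) (OriginLocalization K 4) G₁}) d ∧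
        d * alphaS (fun i => algebraMap (MvPolynomial (Fin 4) K) (OriginLocalization K 4) (∑ t, C (L' i t) * X t))
          (Ideal.span {algebraMap (MvPolynomial (Fin 4) K) (OriginLocalization K 4) G₁}) d ≤ (n - 1) * Nat.factorial d) ∧
      0 < alphaS (fun i => algebraMap (MvPolynomial (Fin 4) K) (OriginLocalization K 4) (∑ t, C (L' i t) * X t))
          (Ideal.span {algebraMap (MvPolynomial (Fin 4) K) (OriginLocalization K 4) G₁}) d ∧
      betaS (fun i => algebraMap (MvPolynomial (Fin 4) K) (OriginLocalization K 4) (∑ t, C (L' i t) * X t))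
          (Ideal.span {algebraMap (MvPolynomial (Fin 4) K) (OriginLocalization K 4) G₁}) d ≤
        betaS (fun i => algebraMap (MvPolynomial (Fin 4) K) (OriginLocalization K 4) (∑ t, C (L i t) * X t))
          (Ideal.span {algebraMap (MvPolynomial (Fin 4) K) (OriginLocalization K 4) G}) d := by
  classical
  set alg := algebraMap (MvPolynomial (Fin 4) K) (OriginLocalization K 4) with halg
  have hp : p ≤ (c k).r.degree + d := hpo.le
  -- (1) the direction of the step lies in the vertex; the y-rows kill it
  have ho : ordZero (c k).F = (((c k).r.degree + d : ℕ) : ℕ∞) := by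
    rw [hF, PhiLine.ordZero_monomial_one_mul, hd, Nat.cast_add]
  have hdirV : direction (j k) (b k) ∈ resVertex (c k) :=
    direction_mem_resVertex_of_shade_eq (j k) hbj ho hdiv hpo ho2 hshade
  have hdir : direction (j k) (b k) = Function.update (b k) (j k) 1 := rfl
  have hdirj : direction (j k) (b k) (j k) = 1 := by rw [hdir, Function.update_self]
  have hdirh : direction (j k) (b k) h ≠ 0 := by
    rcases hhit with hjh | hbh
    · rw [← hjh, hdirj]; exact one_ne_zero
    · have hjh : j k ≠ h := fun hh => hbh (by rw [← hh]; exact hbj)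
      rw [hdir, Function.update_of_ne (Ne.symm hjh)]; exact hbh
  have hyk : ∀ i, i ≠ u1 2 → i ≠ u2 2 → ∑ t, L i t * direction (j k) (b k) t = 0 := fun i h1 h2 => hy i h1 h2 _ hdirV
  -- (2) the twist `ũ₂ = u₂ − λ u₁`
  set lam : K := (∑ t, L (u2 2) t * direction (j k) (b k) t) * (direction (j k) (b k) h)⁻¹ with hlam
  set S : Fin (2 + 2) → Fin 4 → K := Function.update L (u2 2) (L (u2 2) - lam • L (u1 2)) with hS
  have hSq : S (u2 2) = L (u2 2) - lam • L (u1 2) := by rw [hS, Function.update_self]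
  have hSi : ∀ i, i ≠ u2 2 → S i = L i := fun i hi => by rw [hS, Function.update_of_ne hi]
  have hSu1 : S (u1 2) = Pi.single h 1 := by rw [hSi _ u1_ne_u2, hLu1]
  have hMS := twist_left_inverse hM u1_ne_u2 lam hSq hSi
  set MS : Fin 4 → Fin (2 + 2) → K := fun t i => M t i + if i = u1 2 then lam * M t (u2 2) else 0 with hMSdef
  have hMS' : ∀ t u, ∑ i, MS t i * S i u = if t = u then 1 else 0 := hMS
  have hkill : ∀ i, i ≠ u1 2 → ∑ t, S i t * direction (j k) (b k) t = 0 := by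
    intro i hi
    by_cases hi2 : i = u2 2
    · subst hi2
      rw [hSq]
      simp only [Pi.sub_apply, Pi.smul_apply, smul_eq_mul, sub_mul, Finset.sum_sub_distrib, mul_assoc, ← Finset.mul_sum]
      rw [hLu1, sum_single_mul, hlam, inv_mul_cancel_right₀ hdirh, sub_self]
    · rw [hSi i hi2]; exact hyk i hi hi2
  have hyS : ∀ i, i ≠ u1 2 → i ≠ u2 2 → ∀ w ∈ resVertex (c k), ∑ t, S i t * w t = 0 := fun i h1 h2 w hw' => by
    rw [hSi i h2]; exact hy i h1 h2 w hw'
  -- the polygon data in the twisted frame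
  have hgenL := span_range_frame_eq_maximalIdeal L M hM
  have hgenS := span_range_frame_eq_maximalIdeal S MS hMS'
  have hdim := PhiLine.ringKrullDim_originLocalization_two_add_two (K := K)
  have hJμ : Ideal.span {alg G} ≤ maximalIdeal (OriginLocalization K 4) ^ d :=
    PhiLine.span_singleton_algebraMap_le_maximalIdeal_pow hd.symm.le
  have hframeS := frameRow_twist (K := K) lam hSq hSi
  obtain ⟨hneS, hδS, hβS⟩ := PhiLine.twist_binders (fun i => alg (∑ t, C (L i t) * X t)) hgenL hdim (-alg (C lam)) hJμ hne hδ
  rw [← halg] at hframeS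
  rw [← hframeS] at hneS hδS hβS
  -- (3) the common tail: from an arrival frame with the law's outputs to the run invariant
  have hBS := matrix_mul_eq_one_of_sum (L := S) (M := MS) hMS'
  have hSB := mul_eq_one_comm.mp hBS
  obtain ⟨Ψ, hΨ, hΨA, Q, hQmem, hGΨ⟩ :=
    PhiLine.exists_label_of_yRows_annihilate p hdp hF hd hSB hBS he hyS
  have hnear2 : ∀ i : Fin 2, ∑ t, S (Fin.castAdd 2 i) t * Function.update (b k) (j k) 1 t = 0 := fun i => by
    rw [← hdir]; exact hkill _ (castAdd_ne_u1 i)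
  obtain ⟨Q', hH₀⟩ := PhiLine.chartTransform_translate_label hbj (fun i : Fin 2 => S (Fin.castAdd 2 i)) hnear2 hΨ hQmem hGΨ
    hd.symm.le
  obtain ⟨R, hres, hRmem⟩ := PhiLine.step_F_eq_monomial_mul_residual (p := p) hF hd.symm.le hp (j k) hbj
  rw [hF', monomial_one_mul_cancel_left_iff] at hres
  have hr'j : (((c k).r.filter fun i => b k i = 0).update (j k) ((c k).r.degree + d - p)) (j k) = (c k).r.degree + d - p := by
    rw [Finsupp.coe_update, Function.update_self]
  have hpn : p - ((c k).r.degree + d - p) = n := by omega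
  have hR : R ∈ Ideal.span {(X (j k) : MvPolynomial (Fin 4) K) ^ n} := by
    have := hRmem (j k) (by rw [hr'j]; exact hndvd)
    rwa [hr'j, hpn] at this
  have hε := PhiLine.constantCoeff_prod_ne_zero (b k) (fun i => (c k).r i)
  have hT := PhiLine.two_le_finrank_additiveSubspace_of_resVertex hF₁ hd₁ he₁
  have hcrit₁ : p ≤ (c (k + 1)).r (j k) + n := by rw [hr']; omega
  have hcritn : (c k).r.degree + d - p + n ≤ p := hnp.le
  have tail : ∀ (L' : Fin (2 + 2) → Fin 4 → K) (M' : Fin 4 → Fin (2 + 2) → K),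
      (∀ t u, ∑ i, M' t i * L' i u = if t = u then 1 else 0) → L' (u1 2) = Pi.single (j k) 1 →
      (∀ i, i ≠ u1 2 → L' i = Function.update (S i) (j k) 0) →
      alphaS (fun i => alg (∑ t, C (L' i t) * X t)) (Ideal.span {alg G₁}) d + Nat.factorial d =
        deltaS (fun i => alg (∑ t, C (S i t) * X t)) (Ideal.span {alg G}) d →
      betaS (fun i => alg (∑ t, C (L' i t) * X t)) (Ideal.span {alg G₁}) d ≤
        betaS (fun i => alg (∑ t, C (S i t) * X t)) (Ideal.span {alg G}) d →
      ∃ (L'' : Fin (2 + 2) → Fin 4 → K) (M'' : Fin 4 → Fin (2 + 2) → K),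
        ((∀ t u, ∑ i, M'' t i * L'' i u = if t = u then 1 else 0) ∧ L'' (u1 2) = Pi.single (j k) 1 ∧
          (∀ i, i ≠ u1 2 → i ≠ u2 2 → ∀ w ∈ resVertex (c (k + 1)), ∑ t, L'' i t * w t = 0) ∧
          (pts (fun i => alg (∑ t, C (L'' i t) * X t)) (Ideal.span {alg G₁}) d).Nonempty ∧
          Nat.factorial d < deltaS (fun i => alg (∑ t, C (L'' i t) * X t)) (Ideal.span {alg G₁}) d ∧
          d * alphaS (fun i => alg (∑ t, C (L'' i t) * X t)) (Ideal.span {alg G₁}) d ≤ (n - 1) * Nat.factorial d) ∧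
        0 < alphaS (fun i => alg (∑ t, C (L'' i t) * X t)) (Ideal.span {alg G₁}) d ∧
        betaS (fun i => alg (∑ t, C (L'' i t) * X t)) (Ideal.span {alg G₁}) d ≤
          betaS (fun i => alg (∑ t, C (L i t) * X t)) (Ideal.span {alg G}) d := by
    intro L' M' hM' hL'u1 hL' hαeq hβle
    -- the child's polygon in the arrival frame: non-empty, `d·αs′ ≤ (n−1)·d!` ((T2) at the isolated child), hence `0 < αs′ < d!`
    have hgen' := span_range_frame_eq_maximalIdeal L' M' hM'
    have hu1' : (fun i => alg (∑ t, C (L' i t) * X t)) (u1 2) = alg (X (j k)) := by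
      show alg (∑ t, C (L' (u1 2) t) * X t) = alg (X (j k))
      rw [hL'u1, halg, frameRow_single]
    obtain ⟨hne', hα2⟩ := PhiLine.mul_alphaS_le_of_isIsolated (p := p) (d := d) (n := n) hF₁ hiso₁ hcrit₁
      hnd (fun i => alg (∑ t, C (L' i t) * X t)) hgen' hu1'
    have hα2' : d * alphaS (fun i => alg (∑ t, C (L' i t) * X t)) (Ideal.span {alg G₁}) d ≤ (n - 1) * Nat.factorial d := hα2
    have hα' : alphaS (fun i => alg (∑ t, C (L' i t) * X t)) (Ideal.span {alg G₁}) d < Nat.factorial d :=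
      lt_factorial_of_mul_le hα2' hnd hn1
    have hα0 : 0 < alphaS (fun i => alg (∑ t, C (L' i t) * X t)) (Ideal.span {alg G₁}) d := by
      have := hδS; omega
    -- the re-adaptation (XVI, `e = n`, no order hypothesis on the uncleaned weak transform) and the new y-rows (XIII)
    have hB'A := matrix_mul_eq_one_of_sum (L := L') (M := M') hM'
    have hAB' := mul_eq_one_comm.mp hB'A
    have hfun : (fun i : Fin 2 => ∑ t, C (Function.update (S (Fin.castAdd 2 i)) (j k) 0 t) * X t) =
        (fun i : Fin 2 => ∑ t, C (L' (Fin.castAdd 2 i) t) * X t) := by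
      funext i
      rw [hL' _ (castAdd_ne_u1 i)]
    have hH₀' : PointBlowup.translate (b k) (CentreBlowup.chartTransform d Finset.univ (j k) G) =
        aeval (fun i : Fin 2 => ∑ t, C (L' (Fin.castAdd 2 i) t) * X t) Ψ + X (j k) * Q' := by
      rw [hH₀, hfun]
    have hu12 : u1 2 ∈ ({u1 2, u2 2} : Finset (Fin (2 + 2))) := Finset.mem_insert_self _ _
    obtain ⟨lam', A', B', hA'B', hB'A', hrows, hA'u1, hA'u2, hne'', hδ'', hαeq'', hβeq''⟩ :=
      PhiLine.exists_label_readaptation_of_step_pow p (d := d) hdp hAB' hB'A hu12 hL'u1 hL'u1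
        (e := n) hn1 hres hd₁.symm.le hε hR hH₀' hΨ hΨA hT hne' hα0 hα'
    have hy'' := PhiLine.yRows_annihilate_of_label p hdp hF₁ hd₁ hA'B' hB'A' he₁ hδ''
    refine ⟨A', B', ⟨sum_of_matrix_mul_eq_one hB'A', by rw [hA'u1, hL'u1], hy'', hne'', hδ'', by rw [hαeq'']; exact hα2'⟩,
      by rw [hαeq'']; exact hα0, ?_⟩
    rw [hβeq'']
    exact hβle.trans hβS
  -- (4) the two charts
  rcases hhit with hjh | hbh
  · -- chart `h`: the LOSE law from the child side at the (super)critical newborn (XV §4)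
    set L' : Fin (2 + 2) → Fin 4 → K := fun i => if i = u1 2 then Pi.single h 1 else Function.update (S i) h 0 with hL'def
    have hL'u1 : L' (u1 2) = Pi.single h 1 := by rw [hL'def]; exact if_pos rfl
    have hL' : ∀ i, i ≠ u1 2 → L' i = Function.update (S i) h 0 := fun i hi => by rw [hL'def]; exact if_neg hi
    have hM' := arrival_left_inverse hMS' hSu1 hL'u1 hL'
    have hbh : b k h = 0 := by rw [← hjh]; exact hbj
    have hnear : ∀ i, i ≠ u1 2 → ∑ t, S i t * Function.update (b k) h 1 t = 0 := fun i hi => by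
      rw [← hjh, ← hdir]; exact hkill i hi
    have hgen' := span_range_frame_eq_maximalIdeal L' _ hM'
    have hu1' : (fun i => alg (∑ t, C (L' i t) * X t)) (u1 2) = alg (X h) := by
      show alg (∑ t, C (L' (u1 2) t) * X t) = alg (X h)
      rw [hL'u1, halg, frameRow_single]
    obtain ⟨hne', hα2⟩ := PhiLine.mul_alphaS_le_of_isIsolated (p := p) (d := d) (n := n) hF₁ hiso₁
      (h := h) (by rw [← hjh]; exact hcrit₁) hnd (fun i => alg (∑ t, C (L' i t) * X t)) hgen' hu1'
    have hα2' : d * alphaS (fun i => alg (∑ t, C (L' i t) * X t)) (Ideal.span {alg G₁}) d ≤ (n - 1) * Nat.factorial d := hα2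
    have hα' : d * (alphaS (fun i => alg (∑ t, C (L' i t) * X t)) (Ideal.span {alg G₁}) d + 1) ≤ n * Nat.factorial d :=
      mul_succ_le_mul_factorial hα2' hn1
    have hF'' : (CentreBlowup.step p Finset.univ h (b k) (c k)).F =
        monomial (((c k).r.filter fun i => b k i = 0).update h ((c k).r.degree + d - p)) 1 * G₁ := by
      rw [← hjh]; exact hF'
    obtain ⟨hαeq, hβle⟩ := PhiLine.betaS_step_le_of_lose_of_child_pow (n := n) hF hd hp hbh hndvd hcritn
      S L' MS _ hMS' hM' hSu1 hnear hL'u1 hL' hneS hδS hF'' hd₁.symm.le hne' hα'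
    exact tail L' _ hM' (by rw [hL'u1, hjh]) (fun i hi => by rw [hL' i hi, hjh]) hαeq hβle
  · -- chart `j k ≠ h`, `b k h ≠ 0`: the translated law (R3b-n)
    have hjh : j k ≠ h := fun hh => hbh (by rw [← hh]; exact hbj)
    -- replace the pivot row by `e_{j k}`, then drop the `j k`-coefficients
    set S₂ : Fin (2 + 2) → Fin 4 → K := Function.update S (u1 2) (Pi.single (j k) 1) with hS₂
    have hS₂u1 : S₂ (u1 2) = Pi.single (j k) 1 := by rw [hS₂, Function.update_self]
    have hS₂i : ∀ i, i ≠ u1 2 → S₂ i = S i := fun i hi => by rw [hS₂, Function.update_of_ne hi]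
    have ha : ∑ t, (Pi.single (j k) (1 : K) : Fin 4 → K) t * MS t (u1 2) ≠ 0 :=
      coeff_replaceRow_ne_zero hMS' (piv := u1 2) (w := direction (j k) (b k)) hkill (by rw [sum_single_mul, hdirj]; exact one_ne_zero)
    have hM₂ := replaceRow_left_inverse hMS' (u1 2) (Pi.single (j k) 1) ha hS₂u1 hS₂i
    set L' : Fin (2 + 2) → Fin 4 → K := fun i => if i = u1 2 then Pi.single (j k) 1 else Function.update (S i) (j k) 0
      with hL'def
    have hL'u1 : L' (u1 2) = Pi.single (j k) 1 := by rw [hL'def]; exact if_pos rfl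
    have hL' : ∀ i, i ≠ u1 2 → L' i = Function.update (S i) (j k) 0 := fun i hi => by rw [hL'def]; exact if_neg hi
    have hL'₂ : ∀ i, i ≠ u1 2 → L' i = Function.update (S₂ i) (j k) 0 := fun i hi => by rw [hL' i hi, hS₂i i hi]
    have hM' := arrival_left_inverse hM₂ hS₂u1 hL'u1 hL'₂
    have hnear : ∀ i, i ≠ u1 2 → ∑ t, S i t * Function.update (b k) (j k) 1 t = 0 := fun i hi => by
      rw [← hdir]; exact hkill i hi
    have hgen' := span_range_frame_eq_maximalIdeal L' _ hM'
    have hu1' : (fun i => alg (∑ t, C (L' i t) * X t)) (u1 2) = alg (X (j k)) := by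
      show alg (∑ t, C (L' (u1 2) t) * X t) = alg (X (j k))
      rw [hL'u1, halg, frameRow_single]
    obtain ⟨hne', hα2⟩ := PhiLine.mul_alphaS_le_of_isIsolated (p := p) (d := d) (n := n) hF₁ hiso₁ hcrit₁
      hnd (fun i => alg (∑ t, C (L' i t) * X t)) hgen' hu1'
    have hα2' : d * alphaS (fun i => alg (∑ t, C (L' i t) * X t)) (Ideal.span {alg G₁}) d ≤ (n - 1) * Nat.factorial d := hα2
    have hα' : d * (alphaS (fun i => alg (∑ t, C (L' i t) * X t)) (Ideal.span {alg G₁}) d + 1) ≤ n * Nat.factorial d :=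
      mul_succ_le_mul_factorial hα2' hn1
    obtain ⟨hαeq, hβle⟩ := PhiLine.betaS_step_le_of_lose_translated_of_child_pow (n := n) hF hd hp hjh hbj hbh hndvd hcritn
      S L' MS _ hMS' hM' hSu1 hnear hL'u1 hL' hneS hδS hF' hd₁.symm.le hne' hα'
    exact tail L' _ hM' hL'u1 hL' hαeq hβle

end Lose

end ResCone

end Summit.ResolutionOfSingularities.ResolutionOfSingularities.Theorems.PIDim4

end
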